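import Mathlib
import HarnessLib

/-!
# The Moore–Penrose inverse of a matrix

Penrose [Penrose1955, Thm 1] proved that for every (square or rectangular) real or complex matrix
`A` there is a *unique* matrix `X` satisfying the four *Penrose equations*

  `A * X * A = A`, `X * A * X = X`, `(A * X)ᴴ = A * X`, `(X * A)ᴴ = X * A`

([BenIsraelGreville2003, Ch. 1 §1, eqs. (1)–(4)]); this `X` is the Moore–Penrose inverse `A⁺`
(Albert's pseudoinverse, characterised by the same equations in [Albert1972, Thm (3.9)]).

This file records, for matrices over an `RCLike` field `𝕜` with arbitrary finite index types:

* `IsMoorePenroseInverse A X` — the four Penrose equations;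
* `IsMoorePenroseInverse.unique` — uniqueness [Penrose1955, Thm 1; Albert1972, Thm (3.9)];
* `pinv A` and `isMoorePenroseInverse_pinv` — existence [Penrose1955, Thm 1], constructed as
  `(Aᴴ A)⁺ Aᴴ` with `(Aᴴ A)⁺` obtained from the spectral theorem by inverting the non-zero
  eigenvalues [Albert1972, Thm (3.8) eq. (3.8.1) and (3.6)];
* the standard identities `(A⁺)⁺ = A` [Albert1972, (3.11.1)], `(Aᴴ)⁺ = (A⁺)ᴴ` [Albert1972, (3.8.2)],
  `A⁺ = (AᴴA)⁺Aᴴ = Aᴴ(AAᴴ)⁺` [Albert1972, (3.8.1), (3.8.3)], `A⁺ = A⁻¹` for invertible `A`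
  [BenIsraelGreville2003, Ch. 1 §1], and idempotency of `A A⁺`, `A⁺ A`
  [BenIsraelGreville2003, Ch. 1 §3, Lemma 1(f)];
* least squares [Albert1972, Thms (3.1), (3.2), (3.4)]: `x̂ = A⁺ z` solves the normal equations
  `Aᴴ A x = Aᴴ z`, every solution of the normal equations minimises `‖z - A x‖²`
  (written `star r ⬝ᵥ r`), and among them `x̂` is the unique one of minimum norm.

All proofs are elementary matrix algebra; the only analytic input is Mathlib's spectral theorem
`Matrix.IsHermitian.spectral_theorem`.
-/

open Matrix
open scoped ComplexOrder

namespace Literature.LinearAlgebra.Matrix.MoorePenrose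

variable {𝕜 : Type*} [RCLike 𝕜]
variable {m n : Type*} [Fintype m] [Fintype n]

/-- The four **Penrose equations** for a candidate generalized inverse `X` of `A`.
[cite: Penrose1955, Thm 1; BenIsraelGreville2003, Ch. 1 §1 eqs. (1)–(4); Albert1972, Thm (3.9)] -/
structure IsMoorePenroseInverse (A : Matrix m n 𝕜) (X : Matrix n m 𝕜) : Prop where
  /-- Penrose equation (1): `A X A = A`. -/
  mul_mul_self : A * X * A = A
  /-- Penrose equation (2): `X A X = X`. -/
  mul_mul_inv : X * A * X = X
  /-- Penrose equation (3): `A X` is Hermitian. -/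
  isHermitian_mul : (A * X).IsHermitian
  /-- Penrose equation (4): `X A` is Hermitian. -/
  isHermitian_inv_mul : (X * A).IsHermitian

namespace IsMoorePenroseInverse

variable {A : Matrix m n 𝕜} {X Y : Matrix n m 𝕜}

/-- The Penrose equations are symmetric in `A` and `X`: `A` is the Moore–Penrose inverse of `X`.
[cite: Albert1972, (3.11.1); BenIsraelGreville2003, Ch. 1 §6 Ex. 18(a)] -/
theorem symm (hX : IsMoorePenroseInverse A X) : IsMoorePenroseInverse X A :=
  ⟨hX.mul_mul_inv, hX.mul_mul_self, hX.isHermitian_inv_mul, hX.isHermitian_mul⟩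

/-- The Penrose equations pass to conjugate transposes.
[cite: Albert1972, Thm (3.8) eq. (3.8.2); BenIsraelGreville2003, Ch. 1 §6 Ex. 18(b)] -/
theorem conjTranspose (hX : IsMoorePenroseInverse A X) : IsMoorePenroseInverse Aᴴ Xᴴ := by
  refine ⟨?_, ?_, ?_, ?_⟩
  · rw [← conjTranspose_mul, ← conjTranspose_mul, ← Matrix.mul_assoc, hX.mul_mul_self]
  · rw [← conjTranspose_mul, ← conjTranspose_mul, ← Matrix.mul_assoc, hX.mul_mul_inv]
  · rw [← conjTranspose_mul]; exact hX.isHermitian_inv_mul.conjTranspose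
  · rw [← conjTranspose_mul]; exact hX.isHermitian_mul.conjTranspose

/-- Two Moore–Penrose inverses of `A` give the same product `A X` (a step of Penrose's uniqueness
argument). [cite: Albert1972, Thm (3.9) proof, eq. (3.9.7); Penrose1955, Thm 1 (proof)] -/
theorem mul_eq (hX : IsMoorePenroseInverse A X) (hY : IsMoorePenroseInverse A Y) :
    A * X = A * Y := by
  have h1 : A * X = A * Y * (A * X) := by
    rw [← Matrix.mul_assoc, hY.mul_mul_self]
  have h2 : A * X = A * X * (A * Y) := by
    have := congr_arg Matrix.conjTranspose h1
    rwa [conjTranspose_mul (A * Y) (A * X), hX.isHermitian_mul.eq, hY.isHermitian_mul.eq] at this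
  calc A * X = A * X * (A * Y) := h2
    _ = A * X * A * Y := (Matrix.mul_assoc _ _ _).symm
    _ = A * Y := by rw [hX.mul_mul_self]

/-- Two Moore–Penrose inverses of `A` give the same product `X A` (a step of Penrose's uniqueness
argument). [cite: Albert1972, Thm (3.9) proof, eq. (3.9.5); Penrose1955, Thm 1 (proof)] -/
theorem inv_mul_eq (hX : IsMoorePenroseInverse A X) (hY : IsMoorePenroseInverse A Y) :
    X * A = Y * A := by
  have h1 : X * A = X * A * (Y * A) := by
    rw [Matrix.mul_assoc, ← Matrix.mul_assoc A, hY.mul_mul_self]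
  have h2 : X * A = Y * A * (X * A) := by
    have := congr_arg Matrix.conjTranspose h1
    rwa [conjTranspose_mul (X * A) (Y * A), hX.isHermitian_inv_mul.eq, hY.isHermitian_inv_mul.eq]
      at this
  calc X * A = Y * A * (X * A) := h2
    _ = Y * (A * X * A) := by simp only [Matrix.mul_assoc]
    _ = Y * A := by rw [hX.mul_mul_self]

/-- **Penrose's uniqueness theorem**: the four Penrose equations have at most one solution.
[cite: Penrose1955, Thm 1; Albert1972, Thm (3.9); BenIsraelGreville2003, Ch. 1 §1 Ex. 1] -/
theorem unique (hX : IsMoorePenroseInverse A X) (hY : IsMoorePenroseInverse A Y) : X = Y := by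
  calc X = X * A * X := hX.mul_mul_inv.symm
    _ = X * (A * X) := Matrix.mul_assoc _ _ _
    _ = X * (A * Y) := by rw [hX.mul_eq hY]
    _ = X * A * Y := (Matrix.mul_assoc _ _ _).symm
    _ = Y * A * Y := by rw [hX.inv_mul_eq hY]
    _ = Y := hY.mul_mul_inv

/-- `A X` is idempotent. [cite: BenIsraelGreville2003, Ch. 1 §3, Lemma 1(f)] -/
theorem mul_idem (hX : IsMoorePenroseInverse A X) : A * X * (A * X) = A * X := by
  rw [← Matrix.mul_assoc, hX.mul_mul_self]

/-- `X A` is idempotent. [cite: BenIsraelGreville2003, Ch. 1 §3, Lemma 1(f)] -/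
theorem inv_mul_idem (hX : IsMoorePenroseInverse A X) : X * A * (X * A) = X * A := by
  rw [← Matrix.mul_assoc, hX.mul_mul_inv]

end IsMoorePenroseInverse

/-- The zero matrix is its own Moore–Penrose inverse.
[cite: BenIsraelGreville2003, Ch. 1 §2 (proof of Thm 1, case `r = 0`)] -/
theorem isMoorePenroseInverse_zero : IsMoorePenroseInverse (0 : Matrix m n 𝕜) 0 :=
  ⟨by simp, by simp, by simp, by simp⟩

/-! ### Existence: the Hermitian case via the spectral theorem -/

section Hermitian

variable [DecidableEq n] {H : Matrix n n 𝕜}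

/-- Conjugation by a matrix with `Uᴴ U = 1` is multiplicative. [folklore] -/
private theorem conj_mul_conj {U : Matrix n n 𝕜} (hU : Uᴴ * U = 1) (P Q : Matrix n n 𝕜) :
    U * P * Uᴴ * (U * Q * Uᴴ) = U * (P * Q) * Uᴴ := by
  calc U * P * Uᴴ * (U * Q * Uᴴ) = U * P * (Uᴴ * U) * Q * Uᴴ := by
        simp only [Matrix.mul_assoc]
    _ = U * (P * Q) * Uᴴ := by rw [hU, Matrix.mul_one, Matrix.mul_assoc U P Q]

/-- A real diagonal matrix conjugated by `U` is Hermitian. [folklore] -/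
private theorem isHermitian_conj_diagonal (U : Matrix n n 𝕜) (e : n → ℝ) :
    (U * diagonal (fun i => (e i : 𝕜)) * Uᴴ).IsHermitian := by
  refine isHermitian_mul_mul_conjTranspose U (isHermitian_diagonal_of_self_adjoint _ ?_)
  ext i
  simp

/-- `λ λ⁺ λ = λ` for a real scalar cast into `𝕜` (valid also for `λ = 0`). [folklore] -/
private theorem ofReal_mul_inv_mul (r : ℝ) : (r : 𝕜) * (r : 𝕜)⁻¹ * (r : 𝕜) = r := by
  rcases eq_or_ne r 0 with h | h
  · simp [h]
  · rw [mul_inv_cancel₀ (RCLike.ofReal_ne_zero.mpr h), one_mul]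

/-- `λ⁺ λ λ⁺ = λ⁺` for a real scalar cast into `𝕜` (valid also for `λ = 0`). [folklore] -/
private theorem ofReal_inv_mul_mul_inv (r : ℝ) : (r : 𝕜)⁻¹ * (r : 𝕜) * (r : 𝕜)⁻¹ = (r : 𝕜)⁻¹ := by
  rcases eq_or_ne r 0 with h | h
  · simp [h]
  · rw [inv_mul_cancel₀ (RCLike.ofReal_ne_zero.mpr h), one_mul]

/-- The Penrose equations for a unitarily diagonalised matrix and its entrywise pseudo-inverted
diagonalisation. [cite: Albert1972, (3.6); BenIsraelGreville2003, Ch. 1 §6 Ex. 22 and Ex. 25] -/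
theorem isMoorePenroseInverse_conj_diagonal {U : Matrix n n 𝕜} (hU : Uᴴ * U = 1) (d : n → ℝ) :
    IsMoorePenroseInverse (U * diagonal (fun i => (d i : 𝕜)) * Uᴴ)
      (U * diagonal (fun i => (d i : 𝕜)⁻¹) * Uᴴ) := by
  have e₃ : (fun i => (d i : 𝕜) * (d i : 𝕜)⁻¹) = fun i => ((d i * (d i)⁻¹ : ℝ) : 𝕜) := by
    funext i; push_cast; rfl
  have e₄ : (fun i => (d i : 𝕜)⁻¹ * (d i : 𝕜)) = fun i => (((d i)⁻¹ * d i : ℝ) : 𝕜) := by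
    funext i; push_cast; rfl
  refine ⟨?_, ?_, ?_, ?_⟩
  · rw [conj_mul_conj hU, conj_mul_conj hU, diagonal_mul_diagonal, diagonal_mul_diagonal]
    simp only [ofReal_mul_inv_mul]
  · rw [conj_mul_conj hU, conj_mul_conj hU, diagonal_mul_diagonal, diagonal_mul_diagonal]
    simp only [ofReal_inv_mul_mul_inv]
  · rw [conj_mul_conj hU, diagonal_mul_diagonal, e₃]
    exact isHermitian_conj_diagonal U _
  · rw [conj_mul_conj hU, diagonal_mul_diagonal, e₄]
    exact isHermitian_conj_diagonal U _

/-- The pseudoinverse of a Hermitian matrix: invert the non-zero eigenvalues in an orthonormal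
eigenbasis (`λ⁺ = λ⁻¹` for `λ ≠ 0` and `0⁺ = 0`, which is Lean's convention `0⁻¹ = 0`).
[cite: Albert1972, (3.6) (`H⁺ = T D⁺ Tᵀ`); BenIsraelGreville2003, Ch. 1 §6 Ex. 22 and Ex. 25] -/
noncomputable def pinvOfIsHermitian (hH : H.IsHermitian) : Matrix n n 𝕜 :=
  (hH.eigenvectorUnitary : Matrix n n 𝕜) * diagonal (fun i => (hH.eigenvalues i : 𝕜)⁻¹) *
    (hH.eigenvectorUnitary : Matrix n n 𝕜)ᴴ

/-- `Uᴴ U = 1` for the eigenvector matrix. [folklore] -/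
private theorem eigenvectorUnitary_conjTranspose_mul_self (hH : H.IsHermitian) :
    (hH.eigenvectorUnitary : Matrix n n 𝕜)ᴴ * (hH.eigenvectorUnitary : Matrix n n 𝕜) = 1 := by
  rw [← star_eq_conjTranspose]
  exact Unitary.coe_star_mul_self hH.eigenvectorUnitary

/-- The spectral theorem in product form `H = U diag(λ) Uᴴ`. [folklore] -/
private theorem eq_conj_diagonal (hH : H.IsHermitian) :
    H = (hH.eigenvectorUnitary : Matrix n n 𝕜) * diagonal (fun i => (hH.eigenvalues i : 𝕜)) *
      (hH.eigenvectorUnitary : Matrix n n 𝕜)ᴴ := by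
  have h := hH.spectral_theorem
  rw [Unitary.conjStarAlgAut_apply, star_eq_conjTranspose] at h
  exact h

/-- The spectral pseudoinverse of a Hermitian matrix satisfies the Penrose equations.
[cite: Albert1972, Thm (3.9) with (3.6); Penrose1955, Thm 1] -/
theorem isMoorePenroseInverse_pinvOfIsHermitian (hH : H.IsHermitian) :
    IsMoorePenroseInverse H (pinvOfIsHermitian hH) := by
  have key := isMoorePenroseInverse_conj_diagonal (eigenvectorUnitary_conjTranspose_mul_self hH)
    hH.eigenvalues
  rw [← eq_conj_diagonal hH] at key
  exact key

/-- The spectral pseudoinverse of a Hermitian matrix is Hermitian. [cite: Albert1972, (3.6)] -/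
theorem isHermitian_pinvOfIsHermitian (hH : H.IsHermitian) : (pinvOfIsHermitian hH).IsHermitian := by
  have e : (fun i => (hH.eigenvalues i : 𝕜)⁻¹) = fun i => (((hH.eigenvalues i)⁻¹ : ℝ) : 𝕜) := by
    funext i; push_cast; rfl
  unfold pinvOfIsHermitian
  rw [e]
  exact isHermitian_conj_diagonal _ _

end Hermitian

/-! ### Existence: the general case -/

section General

variable [DecidableEq n]

/-- The **Moore–Penrose inverse** `A⁺ := (Aᴴ A)⁺ Aᴴ` of an arbitrary matrix.
[cite: Penrose1955, Thm 1; Albert1972, Thm (3.8) eq. (3.8.1)] -/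
noncomputable def pinv (A : Matrix m n 𝕜) : Matrix n m 𝕜 :=
  pinvOfIsHermitian (isHermitian_conjTranspose_mul_self A) * Aᴴ

/-- **Penrose's existence theorem**: `pinv A` satisfies the four Penrose equations.
[cite: Penrose1955, Thm 1; BenIsraelGreville2003, Ch. 1 §5 Thm 4 (Urquhart); Albert1972, Thm (3.9)] -/
theorem isMoorePenroseInverse_pinv (A : Matrix m n 𝕜) : IsMoorePenroseInverse A (pinv A) := by
  have hP : IsMoorePenroseInverse (Aᴴ * A) (pinvOfIsHermitian (isHermitian_conjTranspose_mul_self A)) :=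
    isMoorePenroseInverse_pinvOfIsHermitian (isHermitian_conjTranspose_mul_self A)
  have hPh : (pinvOfIsHermitian (isHermitian_conjTranspose_mul_self A)).IsHermitian :=
    isHermitian_pinvOfIsHermitian _
  generalize hPdef : pinvOfIsHermitian (isHermitian_conjTranspose_mul_self A) = P at hP hPh
  have hX : pinv A = P * Aᴴ := by rw [pinv, hPdef]
  -- (1): from `AᴴA · P · AᴴA = AᴴA`, cancel the leading `Aᴴ`.
  have h1 : A * (P * Aᴴ) * A = A := by
    have hz : Aᴴ * A * (P * Aᴴ * A - 1) = 0 := by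
      have e : Aᴴ * A * (P * Aᴴ * A) = Aᴴ * A * P * (Aᴴ * A) := by simp only [Matrix.mul_assoc]
      rw [Matrix.mul_sub, Matrix.mul_one, e, hP.mul_mul_self, sub_self]
    have hz' := (conjTranspose_mul_self_mul_eq_zero A _).mp hz
    rw [Matrix.mul_sub, Matrix.mul_one, sub_eq_zero] at hz'
    simpa only [Matrix.mul_assoc] using hz'
  rw [hX]
  refine ⟨h1, ?_, ?_, ?_⟩
  · -- (2): `P Aᴴ A P Aᴴ = (P (AᴴA) P) Aᴴ = P Aᴴ`.
    calc P * Aᴴ * A * (P * Aᴴ) = P * (Aᴴ * A) * P * Aᴴ := by simp only [Matrix.mul_assoc]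
      _ = P * Aᴴ := by rw [hP.mul_mul_inv]
  · -- (3): `A P Aᴴ` is Hermitian since `P` is.
    rw [← Matrix.mul_assoc]
    exact isHermitian_mul_mul_conjTranspose A hPh
  · -- (4): `P Aᴴ A` is Hermitian by Penrose equation (4) for `(AᴴA, P)`.
    rw [Matrix.mul_assoc]
    exact hP.isHermitian_inv_mul

/-- **Penrose's theorem**: the four Penrose equations have exactly one solution.
[cite: Penrose1955, Thm 1; BenIsraelGreville2003, Ch. 1 §1; Albert1972, Thm (3.9)] -/
theorem existsUnique_isMoorePenroseInverse (A : Matrix m n 𝕜) :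
    ∃! X : Matrix n m 𝕜, IsMoorePenroseInverse A X :=
  ⟨pinv A, isMoorePenroseInverse_pinv A, fun _ hY => hY.unique (isMoorePenroseInverse_pinv A)⟩

/-- Characterisation of `pinv A` by the Penrose equations. [cite: Albert1972, Thm (3.9)] -/
theorem isMoorePenroseInverse_iff_eq_pinv {A : Matrix m n 𝕜} {X : Matrix n m 𝕜} :
    IsMoorePenroseInverse A X ↔ X = pinv A :=
  ⟨fun h => h.unique (isMoorePenroseInverse_pinv A), fun h => h ▸ isMoorePenroseInverse_pinv A⟩

/-! ### Standard identities -/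

/-- Penrose equation (1) for `pinv`. [cite: Penrose1955, Thm 1 eq. (1)] -/
theorem mul_pinv_mul_self (A : Matrix m n 𝕜) : A * pinv A * A = A :=
  (isMoorePenroseInverse_pinv A).mul_mul_self

/-- Penrose equation (2) for `pinv`. [cite: Penrose1955, Thm 1 eq. (2)] -/
theorem pinv_mul_self_mul_pinv (A : Matrix m n 𝕜) : pinv A * A * pinv A = pinv A :=
  (isMoorePenroseInverse_pinv A).mul_mul_inv

/-- Penrose equation (3) for `pinv`. [cite: Penrose1955, Thm 1 eq. (3)] -/
theorem isHermitian_mul_pinv (A : Matrix m n 𝕜) : (A * pinv A).IsHermitian :=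
  (isMoorePenroseInverse_pinv A).isHermitian_mul

/-- Penrose equation (4) for `pinv`. [cite: Penrose1955, Thm 1 eq. (4)] -/
theorem isHermitian_pinv_mul (A : Matrix m n 𝕜) : (pinv A * A).IsHermitian :=
  (isMoorePenroseInverse_pinv A).isHermitian_inv_mul

/-- The ordinary inverse of an invertible matrix satisfies the Penrose equations.
[cite: BenIsraelGreville2003, Ch. 1 §1 (remark after eq. (4)) and §3 Lemma 1(b)] -/
theorem isMoorePenroseInverse_inv (A : Matrix n n 𝕜) [Invertible A] :
    IsMoorePenroseInverse A A⁻¹ := by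
  refine ⟨?_, ?_, ?_, ?_⟩
  · rw [Matrix.mul_inv_of_invertible, Matrix.one_mul]
  · rw [Matrix.inv_mul_of_invertible, Matrix.one_mul]
  · rw [Matrix.mul_inv_of_invertible]; exact isHermitian_one
  · rw [Matrix.inv_mul_of_invertible]; exact isHermitian_one

/-- For an invertible matrix the Moore–Penrose inverse is the inverse.
[cite: BenIsraelGreville2003, Ch. 1 §1 (remark after eq. (4)) and §3 Lemma 1(b)] -/
theorem pinv_eq_inv (A : Matrix n n 𝕜) [Invertible A] : pinv A = A⁻¹ :=
  ((isMoorePenroseInverse_inv A).unique (isMoorePenroseInverse_pinv A)).symm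

/-- The identity matrix is its own Moore–Penrose inverse.
[cite: BenIsraelGreville2003, Ch. 1 §1 (remark after eq. (4): nonsingular case)] -/
theorem isMoorePenroseInverse_one : IsMoorePenroseInverse (1 : Matrix n n 𝕜) 1 :=
  ⟨by simp, by simp, by simp, by simp⟩

/-- `1⁺ = 1`. [cite: BenIsraelGreville2003, Ch. 1 §1 (remark after eq. (4): nonsingular case)] -/
theorem pinv_one : pinv (1 : Matrix n n 𝕜) = 1 :=
  (isMoorePenroseInverse_one.unique (isMoorePenroseInverse_pinv _)).symm

/-- `0⁺ = 0`. [cite: BenIsraelGreville2003, Ch. 1 §2 (proof of Thm 1, case `r = 0`)] -/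
theorem pinv_zero : pinv (0 : Matrix m n 𝕜) = 0 :=
  (isMoorePenroseInverse_zero.unique (isMoorePenroseInverse_pinv _)).symm

/-- For a Hermitian matrix, `pinv` is the spectral pseudoinverse. [cite: Albert1972, (3.6)] -/
theorem pinv_eq_pinvOfIsHermitian {H : Matrix n n 𝕜} (hH : H.IsHermitian) :
    pinv H = pinvOfIsHermitian hH :=
  ((isMoorePenroseInverse_pinvOfIsHermitian hH).unique (isMoorePenroseInverse_pinv H)).symm

/-- `A⁺ = (Aᴴ A)⁺ Aᴴ`. [cite: Albert1972, Thm (3.8) eq. (3.8.1); BenIsraelGreville2003, Ch. 1 §6 Ex. 18(d)] -/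
theorem pinv_eq_pinv_conjTranspose_mul_self_mul (A : Matrix m n 𝕜) :
    pinv A = pinv (Aᴴ * A) * Aᴴ := by
  rw [pinv_eq_pinvOfIsHermitian (isHermitian_conjTranspose_mul_self A)]
  rfl

/-- `A A⁺` is idempotent (a projection). [cite: BenIsraelGreville2003, Ch. 1 §3, Lemma 1(f)] -/
theorem mul_pinv_idem (A : Matrix m n 𝕜) : A * pinv A * (A * pinv A) = A * pinv A :=
  (isMoorePenroseInverse_pinv A).mul_idem

/-- `A⁺ A` is idempotent (a projection). [cite: BenIsraelGreville2003, Ch. 1 §3, Lemma 1(f)] -/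
theorem pinv_mul_idem (A : Matrix m n 𝕜) : pinv A * A * (pinv A * A) = pinv A * A :=
  (isMoorePenroseInverse_pinv A).inv_mul_idem

/-- `A⁺ A = (AᴴA)⁺ (AᴴA)`. [cite: Albert1972, (3.9.4) and (3.11.7)] -/
theorem pinv_mul_self_eq (A : Matrix m n 𝕜) : pinv A * A = pinv (Aᴴ * A) * (Aᴴ * A) := by
  rw [pinv_eq_pinv_conjTranspose_mul_self_mul A, Matrix.mul_assoc]

/-- `Aᴴ (A A⁺) = Aᴴ`. [cite: Albert1972, (3.9.5)–(3.9.7)] -/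
theorem conjTranspose_mul_mul_pinv (A : Matrix m n 𝕜) : Aᴴ * (A * pinv A) = Aᴴ := by
  have h := congr_arg Matrix.conjTranspose (mul_pinv_mul_self A)
  rw [conjTranspose_mul (A * pinv A) A, (isHermitian_mul_pinv A).eq] at h
  exact h

/-- `A⁺ A Aᴴ = Aᴴ`: `A⁺ A` fixes the range of `Aᴴ`. [cite: Albert1972, Cor. (3.5) and (3.11.5)] -/
theorem pinv_mul_self_mul_conjTranspose (A : Matrix m n 𝕜) : pinv A * A * Aᴴ = Aᴴ := by
  have h := congr_arg Matrix.conjTranspose (mul_pinv_mul_self A)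
  rw [Matrix.mul_assoc, conjTranspose_mul A (pinv A * A), (isHermitian_pinv_mul A).eq] at h
  exact h

/-- `A A⁺` fixes the range of `A`: `A A⁺ (A v) = A v`. [cite: Albert1972, Cor. (3.5) and (3.7.5)] -/
theorem mul_pinv_mulVec_mulVec_self (A : Matrix m n 𝕜) (v : n → 𝕜) :
    (A * pinv A) *ᵥ (A *ᵥ v) = A *ᵥ v := by
  rw [mulVec_mulVec, mul_pinv_mul_self]

/-- `A⁺ A` fixes the range of `Aᴴ`: `A⁺ A (Aᴴ w) = Aᴴ w`. [cite: Albert1972, Cor. (3.5)] -/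
theorem pinv_mul_self_mulVec_conjTranspose_mulVec (A : Matrix m n 𝕜) (w : m → 𝕜) :
    (pinv A * A) *ᵥ (Aᴴ *ᵥ w) = Aᴴ *ᵥ w := by
  rw [mulVec_mulVec, pinv_mul_self_mul_conjTranspose]

/-- `A` and `A⁺ A` have the same right kernel: `A⁺ A B = 0 ↔ A B = 0`.
[cite: Albert1972, (3.7.9) and (3.11.5)] -/
theorem pinv_mul_self_mul_eq_zero_iff (A : Matrix m n 𝕜) {p : Type*} (B : Matrix n p 𝕜) :
    pinv A * A * B = 0 ↔ A * B = 0 := by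
  constructor
  · intro h
    have := congr_arg (A * ·) h
    simp only [Matrix.mul_zero, ← Matrix.mul_assoc, mul_pinv_mul_self] at this
    exact this
  · intro h
    rw [Matrix.mul_assoc, h, Matrix.mul_zero]

/-! ### Least squares (Albert 1972, Thms (3.1), (3.2), (3.4), Cor. (3.5))

Squared norms are written as `star v ⬝ᵥ v ∈ 𝕜` (non-negative in the star order). -/

/-- `A⁺ z = A⁺ A (A⁺ z)`: the least-squares solution lies in the range of `A⁺ A` (= range of `Aᴴ`).
[cite: Albert1972, Thm (3.4) with Cor. (3.5)] -/
theorem pinv_mul_self_mulVec_pinv_mulVec (A : Matrix m n 𝕜) (z : m → 𝕜) :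
    (pinv A * A) *ᵥ (pinv A *ᵥ z) = pinv A *ᵥ z := by
  rw [mulVec_mulVec, pinv_mul_self_mul_pinv]

/-- **Normal equations**: `x̂ = A⁺ z` solves `Aᴴ A x = Aᴴ z`. [cite: Albert1972, Thm (3.2) eq. (3.2.2)] -/
theorem normalEquations_pinv_mulVec (A : Matrix m n 𝕜) (z : m → 𝕜) :
    (Aᴴ * A) *ᵥ (pinv A *ᵥ z) = Aᴴ *ᵥ z := by
  rw [mulVec_mulVec, Matrix.mul_assoc, conjTranspose_mul_mul_pinv]

omit [DecidableEq n] in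
/-- Pythagoras for a solution of the normal equations: the residual of any other vector splits
orthogonally. [cite: Albert1972, Thm (3.1) (proof) and Ex. (3.1.2)] -/
theorem residual_sq_eq_of_normalEquations (A : Matrix m n 𝕜) (z : m → 𝕜) {x : n → 𝕜}
    (hx : (Aᴴ * A) *ᵥ x = Aᴴ *ᵥ z) (x' : n → 𝕜) :
    star (z - A *ᵥ x') ⬝ᵥ (z - A *ᵥ x') =
      star (z - A *ᵥ x) ⬝ᵥ (z - A *ᵥ x) + star (A *ᵥ (x - x')) ⬝ᵥ (A *ᵥ (x - x')) := by
  have hr : Aᴴ *ᵥ (z - A *ᵥ x) = 0 := by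
    rw [mulVec_sub, mulVec_mulVec, hx, sub_self]
  have hsplit : z - A *ᵥ x' = (z - A *ᵥ x) + A *ᵥ (x - x') := by
    rw [mulVec_sub]; abel
  have c1 : star (z - A *ᵥ x) ⬝ᵥ (A *ᵥ (x - x')) = 0 := by
    rw [dotProduct_mulVec, ← conjTranspose_conjTranspose A, ← star_mulVec,
      conjTranspose_conjTranspose, hr, star_zero, zero_dotProduct]
  have c2 : star (A *ᵥ (x - x')) ⬝ᵥ (z - A *ᵥ x) = 0 := by
    rw [star_mulVec, ← dotProduct_mulVec, hr, dotProduct_zero]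
  rw [hsplit, star_add, add_dotProduct, dotProduct_add, dotProduct_add, c1, c2, add_zero, zero_add]

omit [DecidableEq n] in
/-- Any solution of the normal equations minimises the residual `‖z - A x‖²`.
[cite: Albert1972, Thm (3.2) and Ex. (3.1.2)] -/
theorem residual_sq_le_of_normalEquations (A : Matrix m n 𝕜) (z : m → 𝕜) {x : n → 𝕜}
    (hx : (Aᴴ * A) *ᵥ x = Aᴴ *ᵥ z) (x' : n → 𝕜) :
    star (z - A *ᵥ x) ⬝ᵥ (z - A *ᵥ x) ≤ star (z - A *ᵥ x') ⬝ᵥ (z - A *ᵥ x') := by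
  rw [residual_sq_eq_of_normalEquations A z hx x']
  have h0 : 0 ≤ star (A *ᵥ (x - x')) ⬝ᵥ (A *ᵥ (x - x')) := dotProduct_star_self_nonneg _
  exact le_add_of_nonneg_right h0

/-- **Least squares**: `x̂ = A⁺ z` minimises `‖z - A x‖²` over all `x`.
[cite: Albert1972, Thm (3.4)] -/
theorem residual_sq_pinv_mulVec_le (A : Matrix m n 𝕜) (z : m → 𝕜) (x : n → 𝕜) :
    star (z - A *ᵥ (pinv A *ᵥ z)) ⬝ᵥ (z - A *ᵥ (pinv A *ᵥ z)) ≤ star (z - A *ᵥ x) ⬝ᵥ (z - A *ᵥ x) :=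
  residual_sq_le_of_normalEquations A z (normalEquations_pinv_mulVec A z) x

/-- **Minimum norm**: among the solutions of the normal equations (= the least-squares minimisers),
the norm splits as `‖x‖² = ‖A⁺ z‖² + ‖x - A⁺ z‖²`. [cite: Albert1972, Thm (3.1) and Thm (3.4)] -/
theorem norm_sq_eq_of_normalEquations (A : Matrix m n 𝕜) (z : m → 𝕜) {x : n → 𝕜}
    (hx : (Aᴴ * A) *ᵥ x = Aᴴ *ᵥ z) :
    star x ⬝ᵥ x = star (pinv A *ᵥ z) ⬝ᵥ (pinv A *ᵥ z) +
      star (x - pinv A *ᵥ z) ⬝ᵥ (x - pinv A *ᵥ z) := by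
  set x₀ := pinv A *ᵥ z with hx₀
  have hv : A *ᵥ (x - x₀) = 0 := by
    rw [← conjTranspose_mul_self_mulVec_eq_zero, mulVec_sub, hx, hx₀, normalEquations_pinv_mulVec,
      sub_self]
  have hQ : (pinv A * A) *ᵥ x₀ = x₀ := pinv_mul_self_mulVec_pinv_mulVec A z
  have c1 : star x₀ ⬝ᵥ (x - x₀) = 0 := by
    calc star x₀ ⬝ᵥ (x - x₀) = star ((pinv A * A) *ᵥ x₀) ⬝ᵥ (x - x₀) := by rw [hQ]
      _ = star x₀ ⬝ᵥ ((pinv A * A)ᴴ *ᵥ (x - x₀)) := by rw [star_mulVec, ← dotProduct_mulVec]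
      _ = 0 := by
        rw [(isHermitian_pinv_mul A).eq, ← mulVec_mulVec, hv, mulVec_zero, dotProduct_zero]
  have c2 : star (x - x₀) ⬝ᵥ x₀ = 0 := by
    rw [star_dotProduct, c1, star_zero]
  have hsplit : x = x₀ + (x - x₀) := by abel
  conv_lhs => rw [hsplit]
  rw [star_add, add_dotProduct, dotProduct_add, dotProduct_add, c1, c2, add_zero, zero_add]

/-- **Minimum norm**: `‖A⁺ z‖² ≤ ‖x‖²` for every solution `x` of the normal equations.
[cite: Albert1972, Thm (3.4); BenIsraelGreville2003, Ch. 3] -/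
theorem norm_sq_pinv_mulVec_le_of_normalEquations (A : Matrix m n 𝕜) (z : m → 𝕜) {x : n → 𝕜}
    (hx : (Aᴴ * A) *ᵥ x = Aᴴ *ᵥ z) :
    star (pinv A *ᵥ z) ⬝ᵥ (pinv A *ᵥ z) ≤ star x ⬝ᵥ x := by
  rw [norm_sq_eq_of_normalEquations A z hx]
  have h0 : 0 ≤ star (x - pinv A *ᵥ z) ⬝ᵥ (x - pinv A *ᵥ z) := dotProduct_star_self_nonneg _
  exact le_add_of_nonneg_right h0

/-- **Uniqueness of the minimum-norm least-squares solution**: a solution of the normal equations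
whose norm does not exceed `‖A⁺ z‖` equals `A⁺ z`. [cite: Albert1972, Thm (3.1) and Thm (3.4)] -/
theorem eq_pinv_mulVec_of_normalEquations_of_norm_sq_le (A : Matrix m n 𝕜) (z : m → 𝕜)
    {x : n → 𝕜} (hx : (Aᴴ * A) *ᵥ x = Aᴴ *ᵥ z)
    (hle : star x ⬝ᵥ x ≤ star (pinv A *ᵥ z) ⬝ᵥ (pinv A *ᵥ z)) : x = pinv A *ᵥ z := by
  have h := norm_sq_eq_of_normalEquations A z hx
  have h1 : 0 ≤ star (x - pinv A *ᵥ z) ⬝ᵥ (x - pinv A *ᵥ z) := dotProduct_star_self_nonneg _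
  rw [h] at hle
  have h2 : star (x - pinv A *ᵥ z) ⬝ᵥ (x - pinv A *ᵥ z) ≤ 0 := (add_le_iff_nonpos_right _).mp hle
  have h0 : star (x - pinv A *ᵥ z) ⬝ᵥ (x - pinv A *ᵥ z) = 0 := le_antisymm h2 h1
  exact sub_eq_zero.mp (dotProduct_star_self_eq_zero.mp h0)

variable [DecidableEq m]

/-- `(A⁺)⁺ = A`. [cite: Albert1972, (3.11.1); BenIsraelGreville2003, Ch. 1 §6 Ex. 18(a)] -/
theorem pinv_pinv (A : Matrix m n 𝕜) : pinv (pinv A) = A :=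
  ((isMoorePenroseInverse_pinv A).symm.unique (isMoorePenroseInverse_pinv _)).symm

/-- `(Aᴴ)⁺ = (A⁺)ᴴ`. [cite: Albert1972, Thm (3.8) eq. (3.8.2); BenIsraelGreville2003, Ch. 1 §6 Ex. 18(b)] -/
theorem pinv_conjTranspose (A : Matrix m n 𝕜) : pinv Aᴴ = (pinv A)ᴴ :=
  ((isMoorePenroseInverse_pinv A).conjTranspose.unique (isMoorePenroseInverse_pinv _)).symm

omit [DecidableEq m] in
/-- The Moore–Penrose inverse of a Hermitian matrix is Hermitian. [cite: Albert1972, (3.11.6)] -/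
theorem isHermitian_pinv_of_isHermitian {H : Matrix n n 𝕜} (hH : H.IsHermitian) :
    (pinv H).IsHermitian := by
  have h := pinv_conjTranspose H
  rw [hH.eq] at h
  exact h.symm

omit [DecidableEq m] in
/-- A Hermitian matrix commutes with its Moore–Penrose inverse: `H H⁺ = H⁺ H`.
[cite: Albert1972, (3.11.6)] -/
theorem mul_pinv_comm_of_isHermitian {H : Matrix n n 𝕜} (hH : H.IsHermitian) :
    H * pinv H = pinv H * H := by
  have h := (isHermitian_mul_pinv H).eq
  rw [conjTranspose_mul, hH.eq, (isHermitian_pinv_of_isHermitian hH).eq] at h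
  exact h.symm

/-- `A⁺ = Aᴴ (A Aᴴ)⁺`. [cite: Albert1972, Thm (3.8) eq. (3.8.3); BenIsraelGreville2003, Ch. 1 §6 Ex. 18(d)] -/
theorem pinv_eq_conjTranspose_mul_pinv_mul_self (A : Matrix m n 𝕜) :
    pinv A = Aᴴ * pinv (A * Aᴴ) := by
  have h := pinv_eq_pinv_conjTranspose_mul_self_mul Aᴴ
  rw [conjTranspose_conjTranspose, pinv_conjTranspose] at h
  have h' := congr_arg Matrix.conjTranspose h
  rw [conjTranspose_conjTranspose, conjTranspose_mul, ← pinv_conjTranspose, conjTranspose_mul,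
    conjTranspose_conjTranspose] at h'
  exact h'

/-- `A A⁺ = (AAᴴ)(AAᴴ)⁺`. [cite: Albert1972, (3.11.7)] -/
theorem mul_pinv_self_eq (A : Matrix m n 𝕜) : A * pinv A = A * Aᴴ * pinv (A * Aᴴ) := by
  rw [pinv_eq_conjTranspose_mul_pinv_mul_self A, Matrix.mul_assoc]

end General

end Literature.LinearAlgebra.Matrix.MoorePenrose
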